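import Summits.BirchSwinnertonDyer.BirchSwinnertonDyer.Theorems.ByReductionTypeAtTwoAdditivePotGoodLowerHalfT0NarrowRankLayerDyadicPrimes
import HarnessLib

/-!
# K4 crux `AdditiveRankZeroAtTwo` (19098), children C3″ (22617) / C1″ (22615): the PARITY STEP of the narrow rank certificate on the concrete layers of a
# totally real cubic point field — `h(A_{m+1})` is ODD from `h(A_m)` odd and ONE unit of `A_m` that is not a norm from `A_{m+1} = A_m(√(2 + t_m))`
# (genus theory for the quadratic step `A_{m+1}/A_m`, at most TWO dyadic primes in every layer; KERNEL, any rung `m ≥ 1`)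
# (seat `bsd-2adic-k4-w2` GEN 15; `--supports stmt-BirchSwinnertonDyer-22617 --as helper`)

Cell `bsd-2adic`.  THEOREMS ONLY (no definition, no named fact, no `sorry`).  This is k4-w1 GEN 11's `odd_classNumber_adjoin_sup_layer_two_d316`
(`…NarrowRankCertificate316LayerTwoParity`, the step `m = 1` for ONE cubic with explicit dyadic prime elements of `A₁`) made GENERIC in the cubic and in
the rung `m`: the count «at most two primes of `A_m` above `2`» is obtained WITHOUT prime elements, from Fukuda's index `n₀ = 0` of the cubic field
(k4-w1/k4-w2 `forall_totallyRamifiedFrom_zero_h<L>`) and «at most two primes of `ℚ(θ)` above `2`» (k4-w1 `ncard_primes_above_two_le_two`), through the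
abstract layers of the restricted cyclotomic `ℤ₂`-extension (`ncard_primesOver_two_layer_le`: a dyadic prime of `K_n`, `n ≥ 2`, is TOTALLY ramified over the
cubic `K` — `2ⁿ ∣ e(Q|2) = e(w|2)·e(Q|w)` with `e(w|2) ≤ 3` forces `e(Q|w) ≠ 1`, and the inertia dichotomy at index `0` makes it `[K_n:K]` — hence determined by
its contraction) and transport along `K_n ≅ A_n` (`ncard_primesOver_two_le_of_ringEquiv`) and up the inclusion `A_m ⊆ A_{m+1}` (`ncard_primesOver_two_le_of_algebra`).
It discharges the displayed parities `hK` (with `m = 1` and k4-w1's sextic non-norm units `exists_unit_forall_sq_sub_mul_sq_ne_d<D>`) and `hL` (with `m = 2` and a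
degree-`12` non-norm unit) of GEN 15's `conjA_two_<L>_of_layerBounds₂₃`.

* (prequel `…NarrowRankLayerDyadicPrimes`: `(2 + t_m)·w = 2`; `#{v ⊂ 𝓞 A_m : 2 ∈ v} ≤ 2` via the abstract layers.)
* ★ `odd_classNumber_sup_layer_succ_of_nonNormUnit` — `h(A_m)` odd, and for every root `t` of `Ψ_m` in `A_m` a unit `ε` of `𝓞 A_m` with
  `a² − (2 + t)c² ≠ ε` for all `a, c ∈ A_m` ⟹ `h(A_{m+1})` odd (Chevalley / `AmbiguousClass.odd_classNumber_of_quadratic_of_isTotallyReal_of_forall_sq_sub_mul_sq_ne`;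
  `A_{m+1} = A_m(e)`, `e = ζ + ζ⁻¹`, `e² = 2 + t` with `t = ζ² + ζ⁻² ∈ A_m`; a ramified prime contains `4(2+t)`, hence `2`).

HONEST FRAMING (D-0036 / D-0054 / D-0152): theorems about number fields; nothing is asserted about any curve; closes nothing at the `∀`-level (C3″ 22617 / C1″ 22615
research-open); nothing booked; BSD is not proved by any of this.

References: [Lang1990] Ch. 13 §4 Lemma 4.1; [Gras2003] IV.4; [Washington1997] §13.1 Prop. 13.2, Lemma 13.3; [Fukuda1994] p. 264; [NeukirchANT1999] Ch. I §8–§9,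
Ch. III §2; [Omeara1963] §63B (63:10).
-/

set_option autoImplicit false
-- sibling precedent (`…NarrowRankLayerBoundsDoor.lean`): the directory name repeats the summit name
set_option linter.dupNamespace false

noncomputable section

open scoped Classical IntermediateField NumberField Polynomial

namespace Summit.BirchSwinnertonDyer.BirchSwinnertonDyer.Theorems.AddKatoTwo

open Polynomial IsDedekindDomain NumberField Field IntermediateField Ideal
  Literature.NumberTheory.EllipticCurves Literature.NumberTheory.EllipticCurves.ZpExtension
  Literature.NumberTheory.IwasawaTheory Literature.NumberTheory.NumberFields
  Literature.NumberTheory.NumberFields.ClassGroupNormKernel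
  Literature.NumberTheory.GaloisRepresentations Literature.Geometry.Kaehler.ComplexTorus

/-! ## The parity step `A_m → A_{m+1}` -/

section Parity

variable {p q r : ℤ} {θ : AlgebraicClosure ℚ}

set_option maxHeartbeats 3200000 in
set_option synthInstance.maxHeartbeats 400000 in
/-- ★ **`h(A_{m+1})` is ODD from `h(A_m)` odd and one unit of `A_m` that is not a norm from `A_{m+1}`** (`A_j = ℚ(θ) ⊔ ℚ_j ⊂ ℚ̄`, `ℚ(θ)` a totally real cubic
field with Fukuda index `0` along every cyclotomic `ℤ₂`-extension and at most two primes above `2`; `m ≥ 1`).  The unit datum is asked for EVERY root `t` of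
`Ψ_m` in `A_m` in norm-form currency: a unit `ε` of `𝓞 A_m` with `a² − (2 + t)c² ≠ ε` for all `a, c ∈ A_m` (O'Meara 63:10).  Proof: `A_{m+1} = A_m(e)` with
`e = ζ + ζ⁻¹` (`ζ` a primitive `2^{m+3}`-th root of unity), `e² = 2 + t` for `t = ζ² + ζ⁻² ∈ A_m` a root of `Ψ_m`, `e ∉ A_m` (degree `2^{m+1}` over `ℚ(θ)`);
a prime of `A_m` ramified in `A_{m+1}` contains `4(2 + t)` hence `2` (`(2+t)·w = 2`), and there are at most two such primes (§3); Chevalley's ambiguous class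
number formula (`AmbiguousClass.odd_classNumber_of_quadratic_of_isTotallyReal_of_forall_sq_sub_mul_sq_ne`) concludes.  KERNEL; k4-w1's
`odd_classNumber_adjoin_sup_layer_two_d316` is the case `m = 1`, `d = 316`. [cite: Lang1990, Ch. 13 §4, Lemma 4.1 (PDF pp. 203–204)]
[cite: Gras2003, IV.4 (genus theory)] [cite: Omeara1963, §63B (63:10)] [cite: Washington1997, §13.1 Prop. 13.2] -/
theorem odd_classNumber_sup_layer_succ_of_nonNormUnit (hirr : Irreducible (Cubic.toPoly ⟨1, (p : ℚ), q, r⟩))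
    (hθ : aeval θ (Cubic.toPoly ⟨1, (p : ℚ), q, r⟩) = 0)
    (hreal : haveI : FiniteDimensional ℚ ↥ℚ⟮θ⟯ :=
        IntermediateField.adjoin.finiteDimensional ⟨_, Cubic.monic_of_a_eq_one', by rwa [← aeval_def]⟩
      haveI : NumberField ↥ℚ⟮θ⟯ := NumberField.mk
      IsTotallyReal ↥ℚ⟮θ⟯)
    (hn0 : haveI : FiniteDimensional ℚ ↥ℚ⟮θ⟯ :=
        IntermediateField.adjoin.finiteDimensional ⟨_, Cubic.monic_of_a_eq_one', by rwa [← aeval_def]⟩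
      haveI : NumberField ↥ℚ⟮θ⟯ := NumberField.mk
      ∀ κL : ZpExtension ↥ℚ⟮θ⟯ 2, κL.IsCyclotomic → TotallyRamifiedFrom κL 0)
    (h2 : haveI : FiniteDimensional ℚ ↥ℚ⟮θ⟯ :=
        IntermediateField.adjoin.finiteDimensional ⟨_, Cubic.monic_of_a_eq_one', by rwa [← aeval_def]⟩
      haveI : NumberField ↥ℚ⟮θ⟯ := NumberField.mk
      {w : HeightOneSpectrum (𝓞 ↥ℚ⟮θ⟯) | ((2 : ℕ) : 𝓞 ↥ℚ⟮θ⟯) ∈ w.asIdeal}.ncard ≤ 2)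
    (m : ℕ) (hm : 1 ≤ m)
    (hK : ∀ [NumberField ↥(ℚ⟮θ⟯ ⊔ (CyclotomicZp.zpExtension 2).layer m)], Odd (classNumber ↥(ℚ⟮θ⟯ ⊔ (CyclotomicZp.zpExtension 2).layer m)))
    (hunit : ∀ [NumberField ↥(ℚ⟮θ⟯ ⊔ (CyclotomicZp.zpExtension 2).layer m)],
      ∀ t : ↥(ℚ⟮θ⟯ ⊔ (CyclotomicZp.zpExtension 2).layer m), (fun x : ↥(ℚ⟮θ⟯ ⊔ (CyclotomicZp.zpExtension 2).layer m) => x ^ 2 - 2)^[m] t = 0 →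
        ∃ ε : (𝓞 ↥(ℚ⟮θ⟯ ⊔ (CyclotomicZp.zpExtension 2).layer m))ˣ,
          ∀ a c : ↥(ℚ⟮θ⟯ ⊔ (CyclotomicZp.zpExtension 2).layer m),
            a ^ 2 - (2 + t) * c ^ 2 ≠ ((ε : 𝓞 ↥(ℚ⟮θ⟯ ⊔ (CyclotomicZp.zpExtension 2).layer m)) : ↥(ℚ⟮θ⟯ ⊔ (CyclotomicZp.zpExtension 2).layer m))) :
    haveI : FiniteDimensional ℚ ↥ℚ⟮θ⟯ :=
      IntermediateField.adjoin.finiteDimensional ⟨_, Cubic.monic_of_a_eq_one', by rwa [← aeval_def]⟩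
    haveI : FiniteDimensional ℚ ↥((CyclotomicZp.zpExtension 2).layer (m + 1)) := (CyclotomicZp.zpExtension 2).finiteDimensional_layer_holds (m + 1)
    haveI : NumberField ↥(ℚ⟮θ⟯ ⊔ (CyclotomicZp.zpExtension 2).layer (m + 1)) := NumberField.mk
    Odd (classNumber ↥(ℚ⟮θ⟯ ⊔ (CyclotomicZp.zpExtension 2).layer (m + 1))) := by
  haveI : Fact (Nat.Prime 2) := ⟨Nat.prime_two⟩
  haveI : FiniteDimensional ℚ ↥ℚ⟮θ⟯ :=
    IntermediateField.adjoin.finiteDimensional ⟨_, Cubic.monic_of_a_eq_one', by rwa [← aeval_def]⟩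
  haveI : FiniteDimensional ℚ ↥((CyclotomicZp.zpExtension 2).layer m) := (CyclotomicZp.zpExtension 2).finiteDimensional_layer_holds m
  haveI : FiniteDimensional ℚ ↥((CyclotomicZp.zpExtension 2).layer (m + 1)) :=
    (CyclotomicZp.zpExtension 2).finiteDimensional_layer_holds (m + 1)
  haveI : NumberField ↥ℚ⟮θ⟯ := NumberField.mk
  haveI : NumberField ↥(ℚ⟮θ⟯ ⊔ (CyclotomicZp.zpExtension 2).layer m) := NumberField.mk
  haveI : NumberField ↥(ℚ⟮θ⟯ ⊔ (CyclotomicZp.zpExtension 2).layer (m + 1)) := NumberField.mk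
  set κ := CyclotomicZp.zpExtension 2 with hκdef
  obtain ⟨-, hfin1, h3⟩ := layer_basics hirr hθ hreal m
  obtain ⟨hreal2, hfin2, -⟩ := layer_basics hirr hθ hreal (m + 1)
  haveI := hreal2
  have hodd3 : Odd (Module.finrank ℚ ↥ℚ⟮θ⟯) := by rw [h3]; decide
  -- `e = ζ + ζ⁻¹ ∈ ℚ_{m+1}`, `t = ζ² + ζ⁻² ∈ ℚ_m`, `e² = 2 + t`
  haveI : NeZero (2 ^ (m + 1 + 2) : ℕ) := ⟨pow_ne_zero _ two_ne_zero⟩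
  obtain ⟨ζ, hζ⟩ := HasEnoughRootsOfUnity.exists_primitiveRoot (AlgebraicClosure ℚ) (2 ^ (m + 1 + 2))
  have he : ζ + ζ⁻¹ ∈ κ.layer (m + 1) := CyclotomicZp.add_inv_mem_layer_zpExtension (m + 1) hζ
  have hζ2 : IsPrimitiveRoot (ζ ^ 2) (2 ^ (m + 2)) := hζ.pow (by positivity) (by ring)
  have ht : ζ ^ 2 + (ζ ^ 2)⁻¹ ∈ κ.layer m := CyclotomicZp.add_inv_mem_layer_zpExtension m hζ2
  have he0 : (fun x : AlgebraicClosure ℚ => x ^ 2 - 2)^[m + 1] (ζ + ζ⁻¹) = 0 := NestedSqrtTwo.iterate_add_inv_eq_zero hζ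
  have ht0 : (fun x : AlgebraicClosure ℚ => x ^ 2 - 2)^[m] (ζ ^ 2 + (ζ ^ 2)⁻¹) = 0 := NestedSqrtTwo.iterate_add_inv_eq_zero hζ2
  have hζ0 : ζ ≠ 0 := hζ.ne_zero (by positivity)
  have het : (ζ + ζ⁻¹) ^ 2 = 2 + (ζ ^ 2 + (ζ ^ 2)⁻¹) := by field_simp; ring
  -- the tower `ℚ(θ) ≤ A_m ≤ A_{m+1}`
  have hK1 : ℚ⟮θ⟯ ≤ ℚ⟮θ⟯ ⊔ κ.layer m := le_sup_left
  have hK2 : ℚ⟮θ⟯ ≤ ℚ⟮θ⟯ ⊔ κ.layer (m + 1) := le_sup_left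
  have h12 : ℚ⟮θ⟯ ⊔ κ.layer m ≤ ℚ⟮θ⟯ ⊔ κ.layer (m + 1) := sup_le_sup_left (κ.layer_mono (Nat.le_succ m)) _
  letI : Algebra ↥ℚ⟮θ⟯ ↥(ℚ⟮θ⟯ ⊔ κ.layer m) := (inclusion hK1).toRingHom.toAlgebra
  letI : Algebra ↥ℚ⟮θ⟯ ↥(ℚ⟮θ⟯ ⊔ κ.layer (m + 1)) := (inclusion hK2).toRingHom.toAlgebra
  letI : Algebra ↥(ℚ⟮θ⟯ ⊔ κ.layer m) ↥(ℚ⟮θ⟯ ⊔ κ.layer (m + 1)) := (inclusion h12).toRingHom.toAlgebra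
  have halg12 : ∀ c, algebraMap ↥(ℚ⟮θ⟯ ⊔ κ.layer m) ↥(ℚ⟮θ⟯ ⊔ κ.layer (m + 1)) c = inclusion h12 c := fun _ => rfl
  haveI : IsScalarTower ℚ ↥ℚ⟮θ⟯ ↥(ℚ⟮θ⟯ ⊔ κ.layer m) := IsScalarTower.of_algebraMap_eq fun x => ((inclusion hK1).commutes x).symm
  haveI : IsScalarTower ℚ ↥ℚ⟮θ⟯ ↥(ℚ⟮θ⟯ ⊔ κ.layer (m + 1)) := IsScalarTower.of_algebraMap_eq fun x => ((inclusion hK2).commutes x).symm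
  haveI : IsScalarTower ℚ ↥(ℚ⟮θ⟯ ⊔ κ.layer m) ↥(ℚ⟮θ⟯ ⊔ κ.layer (m + 1)) :=
    IsScalarTower.of_algebraMap_eq fun x => ((inclusion h12).commutes x).symm
  haveI : IsScalarTower ↥ℚ⟮θ⟯ ↥(ℚ⟮θ⟯ ⊔ κ.layer m) ↥(ℚ⟮θ⟯ ⊔ κ.layer (m + 1)) := IsScalarTower.of_algebraMap_eq fun _ => rfl
  haveI : Module.Finite ↥ℚ⟮θ⟯ ↥(ℚ⟮θ⟯ ⊔ κ.layer m) := Module.Finite.of_restrictScalars_finite ℚ ↥ℚ⟮θ⟯ _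
  haveI : Module.Finite ↥ℚ⟮θ⟯ ↥(ℚ⟮θ⟯ ⊔ κ.layer (m + 1)) := Module.Finite.of_restrictScalars_finite ℚ ↥ℚ⟮θ⟯ _
  haveI : Module.Finite ↥(ℚ⟮θ⟯ ⊔ κ.layer m) ↥(ℚ⟮θ⟯ ⊔ κ.layer (m + 1)) := Module.Finite.of_restrictScalars_finite ℚ _ _
  have hdegK1 : Module.finrank ↥ℚ⟮θ⟯ ↥(ℚ⟮θ⟯ ⊔ κ.layer m) = 2 ^ m := by
    have htower := Module.finrank_mul_finrank ℚ ↥ℚ⟮θ⟯ ↥(ℚ⟮θ⟯ ⊔ κ.layer m)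
    rw [h3, hfin1] at htower
    have : 3 * Module.finrank ↥ℚ⟮θ⟯ ↥(ℚ⟮θ⟯ ⊔ κ.layer m) = 3 * 2 ^ m := htower
    omega
  have hdeg12 : Module.finrank ↥(ℚ⟮θ⟯ ⊔ κ.layer m) ↥(ℚ⟮θ⟯ ⊔ κ.layer (m + 1)) = 2 := by
    have htower := Module.finrank_mul_finrank ℚ ↥(ℚ⟮θ⟯ ⊔ κ.layer m) ↥(ℚ⟮θ⟯ ⊔ κ.layer (m + 1))
    rw [hfin1, hfin2, pow_succ] at htower
    have hpos : 0 < 3 * 2 ^ m := by positivity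
    have htower' : 3 * 2 ^ m * Module.finrank ↥(ℚ⟮θ⟯ ⊔ κ.layer m) ↥(ℚ⟮θ⟯ ⊔ κ.layer (m + 1)) = 3 * 2 ^ m * 2 := by
      rw [htower]; ring
    exact Nat.eq_of_mul_eq_mul_left hpos htower'
  haveI : Algebra.IsQuadraticExtension ↥(ℚ⟮θ⟯ ⊔ κ.layer m) ↥(ℚ⟮θ⟯ ⊔ κ.layer (m + 1)) := ⟨hdeg12⟩
  haveI : IsGalois ↥(ℚ⟮θ⟯ ⊔ κ.layer m) ↥(ℚ⟮θ⟯ ⊔ κ.layer (m + 1)) := inferInstance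
  -- `e`, `t` as elements
  have heA : ζ + ζ⁻¹ ∈ ℚ⟮θ⟯ ⊔ κ.layer (m + 1) := (le_sup_right : κ.layer (m + 1) ≤ _) he
  have htA : ζ ^ 2 + (ζ ^ 2)⁻¹ ∈ ℚ⟮θ⟯ ⊔ κ.layer m := (le_sup_right : κ.layer m ≤ _) ht
  set e' : ↥(ℚ⟮θ⟯ ⊔ κ.layer (m + 1)) := ⟨ζ + ζ⁻¹, heA⟩ with he'def
  set t' : ↥(ℚ⟮θ⟯ ⊔ κ.layer m) := ⟨ζ ^ 2 + (ζ ^ 2)⁻¹, htA⟩ with ht'def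
  have he'0 : (fun x : ↥(ℚ⟮θ⟯ ⊔ κ.layer (m + 1)) => x ^ 2 - 2)^[m + 1] e' = 0 := by
    apply (algebraMap ↥(ℚ⟮θ⟯ ⊔ κ.layer (m + 1)) (AlgebraicClosure ℚ)).injective
    rw [NestedSqrtTwo.map_iterate, map_zero]
    exact he0
  have ht'0 : (fun x : ↥(ℚ⟮θ⟯ ⊔ κ.layer m) => x ^ 2 - 2)^[m] t' = 0 := by
    apply (algebraMap ↥(ℚ⟮θ⟯ ⊔ κ.layer m) (AlgebraicClosure ℚ)).injective
    rw [NestedSqrtTwo.map_iterate, map_zero]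
    exact ht0
  have hs : e' ^ 2 = algebraMap ↥(ℚ⟮θ⟯ ⊔ κ.layer m) ↥(ℚ⟮θ⟯ ⊔ κ.layer (m + 1)) (2 + t') := by
    apply (algebraMap ↥(ℚ⟮θ⟯ ⊔ κ.layer (m + 1)) (AlgebraicClosure ℚ)).injective
    rw [halg12]
    change (ζ + ζ⁻¹) ^ 2 = 2 + (ζ ^ 2 + (ζ ^ 2)⁻¹)
    exact het
  -- `e ∉ A_m`: `deg minpoly_{ℚ(θ)}(e) = 2^{m+1} > 2^m = [A_m : ℚ(θ)]`
  have hsK : e' ∉ Set.range (algebraMap ↥(ℚ⟮θ⟯ ⊔ κ.layer m) ↥(ℚ⟮θ⟯ ⊔ κ.layer (m + 1))) := by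
    rintro ⟨c, hc⟩
    have h4 : (minpoly ↥ℚ⟮θ⟯ e').natDegree = 2 ^ (m + 1) := by
      rw [NestedSqrtTwo.minpoly_eq_of_odd_finrank hodd3 e' he'0, NestedSqrtTwo.natDegree_eq]
    rw [← hc, minpoly.algebraMap_eq (algebraMap ↥(ℚ⟮θ⟯ ⊔ κ.layer m) ↥(ℚ⟮θ⟯ ⊔ κ.layer (m + 1))).injective] at h4
    have hle := minpoly.natDegree_le (A := ↥ℚ⟮θ⟯) c
    rw [h4, hdegK1, pow_succ] at hle
    have hpos : 0 < 2 ^ m := by positivity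
    omega
  -- the non-norm unit for the root `t'`
  obtain ⟨εu, hne⟩ := hunit t' ht'0
  -- the integers `t ∈ 𝓞 A_m`, `e ∈ 𝓞 A_{m+1}`, `e² = 2 + t`, `A_{m+1} = A_m[e]`
  set sA : 𝓞 ↥(ℚ⟮θ⟯ ⊔ κ.layer m) := ⟨t', NestedSqrtTwo.isIntegral ht'0⟩ with hsAdef
  have hsAval : ((sA : 𝓞 ↥(ℚ⟮θ⟯ ⊔ κ.layer m)) : ↥(ℚ⟮θ⟯ ⊔ κ.layer m)) = t' := rfl
  set sB : 𝓞 ↥(ℚ⟮θ⟯ ⊔ κ.layer (m + 1)) := ⟨e', NestedSqrtTwo.isIntegral he'0⟩ with hsBdef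
  have hsBval : algebraMap (𝓞 ↥(ℚ⟮θ⟯ ⊔ κ.layer (m + 1))) ↥(ℚ⟮θ⟯ ⊔ κ.layer (m + 1)) sB = e' := rfl
  have hsB2 : sB ^ 2 = algebraMap (𝓞 ↥(ℚ⟮θ⟯ ⊔ κ.layer m)) (𝓞 ↥(ℚ⟮θ⟯ ⊔ κ.layer (m + 1))) (2 + sA) := by
    apply NumberField.RingOfIntegers.coe_injective
    rw [map_pow, hsBval, hs,
      ← IsScalarTower.algebraMap_apply (𝓞 ↥(ℚ⟮θ⟯ ⊔ κ.layer m)) (𝓞 ↥(ℚ⟮θ⟯ ⊔ κ.layer (m + 1))) ↥(ℚ⟮θ⟯ ⊔ κ.layer (m + 1)),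
      IsScalarTower.algebraMap_apply (𝓞 ↥(ℚ⟮θ⟯ ⊔ κ.layer m)) ↥(ℚ⟮θ⟯ ⊔ κ.layer m) ↥(ℚ⟮θ⟯ ⊔ κ.layer (m + 1)), map_add, map_ofNat]
    change _ = algebraMap _ _ (2 + ((sA : 𝓞 ↥(ℚ⟮θ⟯ ⊔ κ.layer m)) : ↥(ℚ⟮θ⟯ ⊔ κ.layer m)))
    rw [hsAval, map_add, map_ofNat]
  have htint : IsIntegral ↥(ℚ⟮θ⟯ ⊔ κ.layer m) e' := (Algebra.IsIntegral.isIntegral (R := ℚ) e').tower_top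
  have hgen : IntermediateField.adjoin ↥(ℚ⟮θ⟯ ⊔ κ.layer m) ({e'} : Set ↥(ℚ⟮θ⟯ ⊔ κ.layer (m + 1))) = ⊤ := by
    have h2le : 2 ≤ (minpoly ↥(ℚ⟮θ⟯ ⊔ κ.layer m) e').natDegree := (minpoly.two_le_natDegree_iff htint).mpr hsK
    refine IntermediateField.eq_of_le_of_finrank_eq le_top ?_
    rw [IntermediateField.adjoin.finrank htint, IntermediateField.finrank_top', hdeg12]
    exact le_antisymm ((minpoly.natDegree_le (A := ↥(ℚ⟮θ⟯ ⊔ κ.layer m)) (x := e')).trans hdeg12.le) h2le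
  have hgenB : Algebra.adjoin ↥(ℚ⟮θ⟯ ⊔ κ.layer m) ({(sB : ↥(ℚ⟮θ⟯ ⊔ κ.layer (m + 1)))} : Set ↥(ℚ⟮θ⟯ ⊔ κ.layer (m + 1))) = ⊤ := by
    rw [← NumberField.RingOfIntegers.coe_eq_algebraMap] at hsBval
    rw [hsBval, ← IntermediateField.adjoin_simple_toSubalgebra_of_isAlgebraic htint.isAlgebraic, hgen, IntermediateField.top_toSubalgebra]
  -- `(2 + t)·w = 2` in `𝓞 A_m`
  have hsA0 : (fun x : 𝓞 ↥(ℚ⟮θ⟯ ⊔ κ.layer m) => x ^ 2 - 2)^[m] sA = 0 := by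
    apply NumberField.RingOfIntegers.coe_injective
    rw [NestedSqrtTwo.map_iterate, map_zero]
    exact ht'0
  obtain ⟨w2, hw2⟩ := exists_mul_eq_two_of_iterate_eq_zero hm hsA0
  -- at most the (≤ 2) dyadic primes of `A_m` ramify in `A_{m+1}`
  have hram : (∏ᶠ v : HeightOneSpectrum (𝓞 ↥(ℚ⟮θ⟯ ⊔ κ.layer m)),
      v.asIdeal.ramificationIdxIn (𝓞 ↥(ℚ⟮θ⟯ ⊔ κ.layer (m + 1)))) ∣ 4 := by
    rw [AmbiguousClass.finprod_ramificationIdxIn_eq_pow_of_prime Nat.prime_two hdeg12]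
    have hsub : {v : HeightOneSpectrum (𝓞 ↥(ℚ⟮θ⟯ ⊔ κ.layer m)) |
        v.asIdeal.ramificationIdxIn (𝓞 ↥(ℚ⟮θ⟯ ⊔ κ.layer (m + 1))) ≠ 1} ⊆
        {v : HeightOneSpectrum (𝓞 ↥(ℚ⟮θ⟯ ⊔ κ.layer m)) | ((2 : ℕ) : 𝓞 ↥(ℚ⟮θ⟯ ⊔ κ.layer m)) ∈ v.asIdeal} := by
      intro v hv
      rw [Set.mem_setOf_eq] at hv ⊢
      by_contra h2v
      apply hv
      haveI := v.isMaximal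
      obtain ⟨Q, hQmax, hQover⟩ := Ideal.exists_maximal_ideal_liesOver_of_isIntegral (S := 𝓞 ↥(ℚ⟮θ⟯ ⊔ κ.layer (m + 1))) v.asIdeal
      haveI := hQmax
      haveI := hQover
      rw [Ideal.ramificationIdxIn_eq_ramificationIdx v.asIdeal Q (↥(ℚ⟮θ⟯ ⊔ κ.layer (m + 1)) ≃ₐ[↥(ℚ⟮θ⟯ ⊔ κ.layer m)] ↥(ℚ⟮θ⟯ ⊔ κ.layer (m + 1)))]
      have hunr : Algebra.IsUnramifiedAt (𝓞 ↥(ℚ⟮θ⟯ ⊔ κ.layer m)) Q := by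
        refine isUnramifiedAt_of_sq_eq hsB2 hgenB Q fun hmem => h2v ?_
        have hu : 4 * (2 + sA) ∈ Q.under (𝓞 ↥(ℚ⟮θ⟯ ⊔ κ.layer m)) := by
          rw [Ideal.under_def, Ideal.mem_comap]; exact hmem
        rw [← Ideal.over_def Q v.asIdeal] at hu
        have h22 : ((2 : ℕ) : 𝓞 ↥(ℚ⟮θ⟯ ⊔ κ.layer m)) = 2 := by norm_num
        rw [h22]
        rcases v.isPrime.mem_or_mem hu with h | h
        · have h4 : (4 : 𝓞 ↥(ℚ⟮θ⟯ ⊔ κ.layer m)) = 2 * 2 := by norm_num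
          rw [h4] at h
          exact (v.isPrime.mem_or_mem h).elim id id
        · have h2' : (2 + sA) * w2 ∈ v.asIdeal := v.asIdeal.mul_mem_right _ h
          rwa [hw2] at h2'
      exact Ideal.ramificationIdx_eq_one_iff.mpr hunr
    have hfin : {v : HeightOneSpectrum (𝓞 ↥(ℚ⟮θ⟯ ⊔ κ.layer m)) | ((2 : ℕ) : 𝓞 ↥(ℚ⟮θ⟯ ⊔ κ.layer m)) ∈ v.asIdeal}.Finite := by
      have h20 : (Ideal.span {((2 : ℕ) : 𝓞 ↥(ℚ⟮θ⟯ ⊔ κ.layer m))} : Ideal (𝓞 ↥(ℚ⟮θ⟯ ⊔ κ.layer m))) ≠ ⊥ := by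
        rw [Ne, Ideal.span_singleton_eq_bot, Nat.cast_ofNat]; exact two_ne_zero
      refine (Ideal.finite_factors h20).subset fun W hW => ?_
      exact (Ideal.dvd_span_singleton).mpr hW
    have hle : {v : HeightOneSpectrum (𝓞 ↥(ℚ⟮θ⟯ ⊔ κ.layer m)) |
        v.asIdeal.ramificationIdxIn (𝓞 ↥(ℚ⟮θ⟯ ⊔ κ.layer (m + 1))) ≠ 1}.ncard ≤ 2 :=
      (Set.ncard_le_ncard hsub hfin).trans (ncard_primesOver_two_sup_layer_le_two hirr hθ hn0 h2 m)
    calc 2 ^ {v : HeightOneSpectrum (𝓞 ↥(ℚ⟮θ⟯ ⊔ κ.layer m)) |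
          v.asIdeal.ramificationIdxIn (𝓞 ↥(ℚ⟮θ⟯ ⊔ κ.layer (m + 1))) ≠ 1}.ncard ∣ 2 ^ 2 := pow_dvd_pow 2 hle
      _ = 4 := by norm_num
  have hne' : ∀ a c : ↥(ℚ⟮θ⟯ ⊔ κ.layer m),
      a ^ 2 - (2 + t') * c ^ 2 ≠ ((εu : 𝓞 ↥(ℚ⟮θ⟯ ⊔ κ.layer m)) : ↥(ℚ⟮θ⟯ ⊔ κ.layer m)) := hne
  exact AmbiguousClass.odd_classNumber_of_quadratic_of_isTotallyReal_of_forall_sq_sub_mul_sq_ne hdeg12 hram hs hsK εu hne' hK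

end Parity

end Summit.BirchSwinnertonDyer.BirchSwinnertonDyer.Theorems.AddKatoTwo

end
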